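import Literature.Barriers.CriticalPhenomena.PlaquetteWalkHoleRootShutRow
import Literature.Barriers.CriticalPhenomena.PlaquetteWalkHoleRootShutRowEast
import Literature.Barriers.CriticalPhenomena.PlaquetteWalkHoleRootWallPocket
import Literature.Barriers.CriticalPhenomena.PlaquetteWalkHoleRootEastWall
import Literature.Barriers.CriticalPhenomena.PlaquetteWalkHoleRootPrefixWall
import HarnessLib

/-!
# Barrier catalogue (SAWScalingLimit): LAW L BY WALLS — every single boundary cell next to a box's hole, classified

Assembly leaf (no new mechanism) of the lane's LAW L programme: `PlaquetteWalkHoleRootLawLBoxes` (the four corner kills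
and their signs), `…ShutRow` (the cell below `farSW` empties the under route), `…ShutRowEast` (the cell below `rootS`
`w₁`-kills it), `…PrefixWall` (the cell below the hole empties it), `…WallPocket` (a western pocket on the wall
empties it), `…EastWall` (the root plaquette's eastern neighbour on the wall empties both routes; eastern pockets give
the honeycomb zeros) and the far-cell door-closed zero of `PlaquetteWalkHoleRootFarCellLaw`. Setting: the `m × n` box
of faces with one cell `h` removed (the hole) and the Yang–Baxter vertex functional `VF(θ)` at the far cell
`(h.1 − 1, h.2)` of the root plaquette `(h.1 + 1, h.2)`, printed weights, `θ ∈ [π/3, 2π/3]`; one further BOUNDARY cell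
removed. The hole sits two cells from the wall in question and at least two from the others. THE TABLE, one theorem per
wall: ★★★★★ `lawL_bottomWall_exists_ne_zero` — bottom wall (`h.2 = 2`), cell `(x, 0)` with `|x − h.1| ≤ 2`: the vertex
relation FAILS somewhere on the range (at `π/3` for the two western cells' kill, on the whole range for the three
emptied routes, at `2π/3` for the two eastern ones) — all five near cells break it; ★★★★★ `lawL_topWall_exists_ne_zero`
— the mirror; ★★★★★ `lawL_westWall_exists_ne_zero` / `lawL_westWall_farWW_eq_zero` — west wall (`h.1 = 2`), cell
`(0, y)`, `|y − h.2| ≤ 2`: four cells break it, the far cell's outer neighbour `(0, h.2)` RESTORES it identically (a door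
of the far cell is closed); ★★★★★ `lawL_eastWall_corner_exists_ne_zero` / `lawL_eastWall_middle_exists_eq_zero` — east
wall (`h.1 + 3 = m`), cell `(h.1 + 2, y)`: the two corners break it, the three middle cells RESTORE it (identically for
`y = h.2`; at the dual angle `2π/3`, resp. the honeycomb angle `π/3`, for the pockets `y = h.2 ∓ 1`). Cells of the
boundary outside the hole's closed `5 × 5` ring kill nothing (`PlaquetteWalkHoleRootLawLDichotomy`). This is the
honest final form of the lane's pre-registered «LAW L» (FINDING-YB-KILL-FORCED-ZEROS §§15–19).

Not in print; venture lane «pcv-sawmu», seat b-step0 gen 26.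

References: A. Glazman, I. Manolescu, arXiv:1708.00395v3, §1, §2.1 and Lemma 2.1 [GlazmanManolescu2019]; A. Glazman,
Electron. Commun. Probab. 20 (2015) no. 86, Lemma 3.1, proof pp. 6–7 [Glazman2015WeightedSAW].
-/

noncomputable section

open Set Function Complex

namespace Literature.Barriers.CriticalPhenomena.PlaquetteWalk

open Literature.Probability.RandomPlanarGeometry.SAW.YangBaxter
open Real Complex

section Walls

variable {m n : ℕ} {h : Face}

/-- A complex number with non-zero imaginary part is non-zero. [folklore] -/
private theorem ne_zero_of_im_ne_zeroW {z : ℂ} (hz : z.im ≠ 0) : z ≠ 0 := fun e => hz (by rw [e]; rfl)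

/-- `π/3` lies in the printed range. [cite: GlazmanManolescu2019, §1 (the range θ ∈ [π/3, 2π/3])] -/
private theorem pi_div_three_mem_Icc_walls : π / 3 ∈ Set.Icc (π / 3) (2 * π / 3) := ⟨le_rfl, by linarith [Real.pi_pos]⟩

/-- `2π/3` lies in the printed range. [cite: GlazmanManolescu2019, §1 (the range θ ∈ [π/3, 2π/3])] -/
private theorem two_pi_div_three_mem_Icc_walls : 2 * π / 3 ∈ Set.Icc (π / 3) (2 * π / 3) :=
  ⟨by linarith [Real.pi_pos], le_rfl⟩

/-! ## The bottom wall -/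

/-- ★★★★★ **LAW L, BOTTOM WALL: every one of the five bottom cells under the hole's ring breaks the vertex relation.**
Box `m × n`, hole `h` two rows above the bottom wall (`h.2 = 2`, `2 ≤ h.1`, `h.1 + 3 ≤ m`, `h.2 + 3 ≤ n`), one bottom
cell `(x, 0)` with `|x − h.1| ≤ 2` removed: the far-cell vertex functional is non-zero for some `θ ∈ [π/3, 2π/3]`
(`x = h.1 − 2`: the `K_S2` kill, `Im VF(π/3) > 0`; `x = h.1 − 1, h.1`: the under route is empty, `VF ≠ 0` on the whole
range; `x = h.1 + 1`: the under route is `w₁`-killed, `Im VF(2π/3) > 0`; `x = h.1 + 2`: the `K_S1` kill).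
[cite: GlazmanManolescu2019, Lemma 2.1 (statement, "in the form given in [Gl]"), §2.1] [cite: Glazman2015WeightedSAW, Lemma 3.1 (proof, pp. 6–7)] -/
theorem lawL_bottomWall_exists_ne_zero (hW : 2 ≤ h.1) (hE : h.1 + 3 ≤ m) (hS : h.2 = 2) (hN : h.2 + 3 ≤ n) {x : ℤ}
    (hx : h.1 - 2 ≤ x ∧ x ≤ h.1 + 2) :
    ∃ θ ∈ Set.Icc (π / 3) (2 * π / 3), vertexFunctional (printedWeights θ) tFiveEighths (ybCoeff θ)
      (boxMinus m n [h, (x, 0)]) (Face.side (h.1 + 1, h.2) .W) (farW (h.1 + 1, h.2)) ≠ 0 := by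
  obtain ⟨hx1, hx2⟩ := hx
  have hcases : x = h.1 - 2 ∨ x = h.1 - 1 ∨ x = h.1 ∨ x = h.1 + 1 ∨ x = h.1 + 2 := by omega
  rcases hcases with rfl | rfl | rfl | rfl | rfl
  · refine ⟨π / 3, pi_div_three_mem_Icc_walls, ?_⟩
    have e : killSW ((h.1 + 1, h.2) : Face) = ((h.1 - 2, 0) : Face) := Prod.ext (by simp only [killSW]; ring) (by
      simp only [killSW]; omega)
    rw [← e]
    exact ne_zero_of_im_ne_zeroW (lawL_box_killSW_sign hW hE (by omega) hN (Or.inr hS)).ne'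
  · exact ⟨π / 3, pi_div_three_mem_Icc_walls,
      lawL_box_farSWS_vertexFunctional_ne_zero hW hE hS hN pi_div_three_mem_Icc_walls⟩
  · exact ⟨π / 3, pi_div_three_mem_Icc_walls,
      lawL_box_holeSS_vertexFunctional_ne_zero hW hE hS hN pi_div_three_mem_Icc_walls⟩
  · exact ⟨2 * π / 3, two_pi_div_three_mem_Icc_walls,
      ne_zero_of_im_ne_zeroW (lawL_box_rootSS_im_two_pi_div_three_pos hW hE hS hN).ne'⟩
  · refine ⟨2 * π / 3, two_pi_div_three_mem_Icc_walls, ?_⟩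
    have e : killSE ((h.1 + 1, h.2) : Face) = ((h.1 + 2, 0) : Face) := Prod.ext (by simp only [killSE]; ring) (by
      simp only [killSE]; omega)
    rw [← e]
    exact ne_zero_of_im_ne_zeroW (lawL_box_killSE_sign hW hE (by omega) hN (Or.inr hS)).ne'

/-! ## The top wall -/

/-- The two under blocks fit in the box when the hole is two rows below the top wall and the top cell above `farNW`,
`(h.1 − 1, h.2 + 2)`, is removed. [cite: GlazmanManolescu2019, §2.1 (finite domains of faces)] -/
theorem underBlocks_hroot_subset_boxMinus_farNWN (hW : 2 ≤ h.1) (hE : h.1 + 3 ≤ m) (hS : 2 ≤ h.2) (hN : h.2 + 3 = n) :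
    (∀ c ∈ underBlockW (h.1 + 1, h.2), c ∈ boxMinus m n [h, (h.1 - 1, h.2 + 2)]) ∧
      ∀ c ∈ underBlockE (h.1 + 1, h.2), c ∈ boxMinus m n [h, (h.1 - 1, h.2 + 2)] := by
  have bW : ∀ c ∈ underBlockW42, 1 ≤ c.1 ∧ c.1 ≤ 5 ∧ 0 ≤ c.2 ∧ c.2 ≤ 3 ∧ c ≠ (3, 2) := by decide
  have bE : ∀ c ∈ underBlockE42, 1 ≤ c.1 ∧ c.1 ≤ 5 ∧ 0 ≤ c.2 ∧ c.2 ≤ 3 ∧ c ≠ (3, 2) := by decide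
  constructor
  · intro c hc
    simp only [underBlockW, List.mem_map] at hc
    obtain ⟨a, ha, rfl⟩ := hc
    obtain ⟨b1, b2, b3, b4, b5⟩ := bW a ha
    obtain ⟨x, y⟩ := a
    simp only [ne_eq, Prod.mk.injEq, not_and] at b1 b2 b3 b4 b5
    rw [shiftBy_refShift_mk, mem_boxMinus]
    simp only [List.mem_cons, List.not_mem_nil, or_false, not_or]
    refine ⟨⟨by omega, by omega, by omega, by omega⟩, fun e => ?_, fun e => ?_⟩
    · have e' := Prod.ext_iff.1 e; simp only at e'; omega
    · have e' := Prod.ext_iff.1 e; simp only at e'; omega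
  · intro c hc
    simp only [underBlockE, List.mem_map] at hc
    obtain ⟨a, ha, rfl⟩ := hc
    obtain ⟨b1, b2, b3, b4, b5⟩ := bE a ha
    obtain ⟨x, y⟩ := a
    simp only [ne_eq, Prod.mk.injEq, not_and] at b1 b2 b3 b4 b5
    rw [shiftBy_refShift_mk, mem_boxMinus]
    simp only [List.mem_cons, List.not_mem_nil, or_false, not_or]
    refine ⟨⟨by omega, by omega, by omega, by omega⟩, fun e => ?_, fun e => ?_⟩
    · have e' := Prod.ext_iff.1 e; simp only at e'; omega
    · have e' := Prod.ext_iff.1 e; simp only at e'; omega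

/-- ★★★★ **Top-wall mirror of the shut row: removing `(h.1 − 1, n − 1)` above `farNW` (hole two rows below the top wall)
⇒ `Im VF(θ) < 0` on the whole range** (over route empty). [cite: GlazmanManolescu2019, Lemma 2.1 (statement, "in the form given in [Gl]"), §2.1]
[cite: Glazman2015WeightedSAW, Lemma 3.1 (proof, pp. 6–7)] -/
theorem lawL_box_farNWN_im_neg (hW : 2 ≤ h.1) (hE : h.1 + 3 ≤ m) (hS : 2 ≤ h.2) (hN : h.2 + 3 = n) {θ : ℝ}
    (hθ : θ ∈ Set.Icc (π / 3) (2 * π / 3)) :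
    (vertexFunctional (printedWeights θ) tFiveEighths (ybCoeff θ) (boxMinus m n [h, (h.1 - 1, h.2 + 2)])
      (Face.side (h.1 + 1, h.2) .W) (farW (h.1 + 1, h.2))).im < 0 := by
  obtain ⟨hBW, hBE⟩ := underBlocks_hroot_subset_boxMinus_farNWN hW hE hS hN
  refine im_vertexFunctional_printed_neg_of_farNWN hθ hBW hBE ?_ ?_ ?_ fun y hy => ?_
  · rw [mem_boxMinus]; simp only [farW, List.mem_cons, List.not_mem_nil, or_false, not_or]
    refine ⟨⟨by omega, by omega, by omega, by omega⟩, fun e => ?_, fun e => ?_⟩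
    · have e' := Prod.ext_iff.1 e; simp only at e'; omega
    · have e' := Prod.ext_iff.1 e; simp only at e'; omega
  · rw [holeFaceW_hroot]; exact not_mem_dom_boxMinus_of_mem (by simp)
  · have e : (((h.1 + 1, h.2) : Face).1 - 2, ((h.1 + 1, h.2) : Face).2 + 2) = ((h.1 - 1, h.2 + 2) : Face) :=
      Prod.ext (by simp only; ring) rfl
    rw [e]; exact not_mem_dom_boxMinus_of_mem (by simp)
  · left; intro hm; have hb := (mem_dom_boxMinus.1 hm).1; simp only at hb hy; omega

/-- ★★★★★ **LAW L, TOP WALL: every one of the five top cells over the hole's ring breaks the vertex relation** (hole two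
rows below the top wall, `h.2 + 3 = n`; cell `(x, n − 1) = (x, h.2 + 2)`, `|x − h.1| ≤ 2`).
[cite: GlazmanManolescu2019, Lemma 2.1 (statement, "in the form given in [Gl]"), §2.1] [cite: Glazman2015WeightedSAW, Lemma 3.1 (proof, pp. 6–7)] -/
theorem lawL_topWall_exists_ne_zero (hW : 2 ≤ h.1) (hE : h.1 + 3 ≤ m) (hS : 2 ≤ h.2) (hN : h.2 + 3 = n) {x : ℤ}
    (hx : h.1 - 2 ≤ x ∧ x ≤ h.1 + 2) :
    ∃ θ ∈ Set.Icc (π / 3) (2 * π / 3), vertexFunctional (printedWeights θ) tFiveEighths (ybCoeff θ)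
      (boxMinus m n [h, (x, h.2 + 2)]) (Face.side (h.1 + 1, h.2) .W) (farW (h.1 + 1, h.2)) ≠ 0 := by
  obtain ⟨hx1, hx2⟩ := hx
  have hcases : x = h.1 - 2 ∨ x = h.1 - 1 ∨ x = h.1 ∨ x = h.1 + 1 ∨ x = h.1 + 2 := by omega
  rcases hcases with rfl | rfl | rfl | rfl | rfl
  · refine ⟨2 * π / 3, two_pi_div_three_mem_Icc_walls, ?_⟩
    have e : killNW ((h.1 + 1, h.2) : Face) = ((h.1 - 2, h.2 + 2) : Face) :=
      Prod.ext (by simp only [killNW]; ring) (by simp only [killNW])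
    rw [← e]
    exact ne_zero_of_im_ne_zeroW (lawL_box_killNW_sign hW hE hS (by omega) (Or.inr hN)).ne
  · exact ⟨π / 3, pi_div_three_mem_Icc_walls,
      ne_zero_of_im_ne_zeroW (lawL_box_farNWN_im_neg hW hE hS hN pi_div_three_mem_Icc_walls).ne⟩
  · exact ⟨π / 3, pi_div_three_mem_Icc_walls,
      ne_zero_of_im_ne_zeroW (lawL_box_holeNN_im_neg hW hE hS hN pi_div_three_mem_Icc_walls).ne⟩
  · exact ⟨π / 3, pi_div_three_mem_Icc_walls,
      ne_zero_of_im_ne_zeroW (lawL_box_rootNN_im_pi_div_three_neg hW hE hS hN).ne⟩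
  · refine ⟨π / 3, pi_div_three_mem_Icc_walls, ?_⟩
    have e : killNE ((h.1 + 1, h.2) : Face) = ((h.1 + 2, h.2 + 2) : Face) :=
      Prod.ext (by simp only [killNE]; ring) (by simp only [killNE])
    rw [← e]
    exact ne_zero_of_im_ne_zeroW (lawL_box_killNE_sign hW hE hS (by omega) (Or.inr hN)).ne

/-! ## The west wall -/

/-- ★★★★★ **LAW L, WEST WALL: four of the five west cells next to the hole's ring break the vertex relation** (hole two
columns from the west wall, `h.1 = 2`; cell `(0, y)`, `|y − h.2| ≤ 2`, `y ≠ h.2`: the corner kills `K_S2`/`K_N2` and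
the two wall pockets). [cite: GlazmanManolescu2019, Lemma 2.1 (statement, "in the form given in [Gl]"), §2.1]
[cite: Glazman2015WeightedSAW, Lemma 3.1 (proof, pp. 6–7)] -/
theorem lawL_westWall_exists_ne_zero (hW : h.1 = 2) (hE : h.1 + 3 ≤ m) (hS : 2 ≤ h.2) (hN : h.2 + 3 ≤ n) {y : ℤ}
    (hy : h.2 - 2 ≤ y ∧ y ≤ h.2 + 2) (hy0 : y ≠ h.2) :
    ∃ θ ∈ Set.Icc (π / 3) (2 * π / 3), vertexFunctional (printedWeights θ) tFiveEighths (ybCoeff θ)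
      (boxMinus m n [h, (0, y)]) (Face.side (h.1 + 1, h.2) .W) (farW (h.1 + 1, h.2)) ≠ 0 := by
  obtain ⟨hy1, hy2⟩ := hy
  have hcases : y = h.2 - 2 ∨ y = h.2 - 1 ∨ y = h.2 + 1 ∨ y = h.2 + 2 := by omega
  rcases hcases with rfl | rfl | rfl | rfl
  · refine ⟨π / 3, pi_div_three_mem_Icc_walls, ?_⟩
    have e : killSW ((h.1 + 1, h.2) : Face) = ((0, h.2 - 2) : Face) :=
      Prod.ext (by simp only [killSW]; omega) (by simp only [killSW])
    rw [← e]
    exact ne_zero_of_im_ne_zeroW (lawL_box_killSW_sign (by omega) hE hS hN (Or.inl hW)).ne'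
  · exact ⟨π / 3, pi_div_three_mem_Icc_walls,
      lawL_box_wallPocketSW_vertexFunctional_ne_zero hW hE hS hN pi_div_three_mem_Icc_walls⟩
  · exact ⟨π / 3, pi_div_three_mem_Icc_walls,
      ne_zero_of_im_ne_zeroW (lawL_box_wallPocketNW_im_neg hW hE hS hN pi_div_three_mem_Icc_walls).ne⟩
  · refine ⟨2 * π / 3, two_pi_div_three_mem_Icc_walls, ?_⟩
    have e : killNW ((h.1 + 1, h.2) : Face) = ((0, h.2 + 2) : Face) :=
      Prod.ext (by simp only [killNW]; omega) (by simp only [killNW])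
    rw [← e]
    exact ne_zero_of_im_ne_zeroW (lawL_box_killNW_sign (by omega) hE hS hN (Or.inl hW)).ne

/-- ★★★★ **LAW L, WEST WALL, THE FIFTH CELL: removing the far cell's outer neighbour `(0, h.2)` RESTORES the vertex
relation identically** (a door of the far cell is closed: no class-`B2a` walk at the far cell is wound).
[cite: GlazmanManolescu2019, Lemma 2.1 (proof: [Gl])] [cite: Glazman2015WeightedSAW, Lemma 3.1 (proof, pp. 6–7)] -/
theorem lawL_westWall_farWW_eq_zero (hW : h.1 = 2) (hE : h.1 + 3 ≤ m) (hS : 0 ≤ h.2) (hN : h.2 + 1 ≤ n) {θ : ℝ}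
    (hθ : θ ∈ Set.Icc (π / 3) (2 * π / 3)) :
    vertexFunctional (printedWeights θ) tFiveEighths (ybCoeff θ) (boxMinus m n [h, (0, h.2)])
      (Face.side (h.1 + 1, h.2) .W) (farW (h.1 + 1, h.2)) = 0 := by
  have hf : farW ((h.1 + 1, h.2) : Face) ∈ boxMinus m n [h, (0, h.2)] := by
    rw [mem_boxMinus]; simp only [farW, List.mem_cons, List.not_mem_nil, or_false, not_or]
    refine ⟨⟨by omega, by omega, by omega, by omega⟩, fun e => ?_, fun e => ?_⟩
    · have e' := Prod.ext_iff.1 e; simp only at e'; omega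
    · have e' := Prod.ext_iff.1 e; simp only at e'; omega
  have hh : holeFaceW ((h.1 + 1, h.2) : Face) ∉ dom (boxMinus m n [h, (0, h.2)]) := by
    rw [holeFaceW_hroot]; exact not_mem_dom_boxMinus_of_mem (by simp)
  have hr : RootedFace (dom (boxMinus m n [h, (0, h.2)])) (Face.side (h.1 + 1, h.2) .W) (farW (h.1 + 1, h.2)) :=
    ⟨hf, fun hb => hh (by rw [root_faces_W] at hb; exact hb.1)⟩
  refine vertexFunctional_printed_farCellW_eq_zero_of_door_closed hθ _ _ hf hh (Or.inr (Or.inr ?_)) hr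
  have e : farWW ((h.1 + 1, h.2) : Face) = ((0, h.2) : Face) := Prod.ext (by simp only [farWW]; omega) rfl
  rw [e]; exact not_mem_dom_boxMinus_of_mem (by simp)

/-! ## The east wall -/

/-- ★★★★★ **LAW L, EAST WALL: the two corners break the vertex relation** (hole two columns from the east wall,
`h.1 + 3 = m`; cells `(h.1 + 2, h.2 ∓ 2)` = `K_S1`, `K_N1`).
[cite: GlazmanManolescu2019, Lemma 2.1 (statement, "in the form given in [Gl]"), §2.1] [cite: Glazman2015WeightedSAW, Lemma 3.1 (proof, pp. 6–7)] -/
theorem lawL_eastWall_corner_exists_ne_zero (hW : 2 ≤ h.1) (hE : h.1 + 3 = m) (hS : 2 ≤ h.2) (hN : h.2 + 3 ≤ n)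
    {y : ℤ} (hy : y = h.2 - 2 ∨ y = h.2 + 2) :
    ∃ θ ∈ Set.Icc (π / 3) (2 * π / 3), vertexFunctional (printedWeights θ) tFiveEighths (ybCoeff θ)
      (boxMinus m n [h, (h.1 + 2, y)]) (Face.side (h.1 + 1, h.2) .W) (farW (h.1 + 1, h.2)) ≠ 0 := by
  rcases hy with rfl | rfl
  · refine ⟨2 * π / 3, two_pi_div_three_mem_Icc_walls, ?_⟩
    have e : killSE ((h.1 + 1, h.2) : Face) = ((h.1 + 2, h.2 - 2) : Face) :=
      Prod.ext (by simp only [killSE]; ring) (by simp only [killSE])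
    rw [← e]
    exact ne_zero_of_im_ne_zeroW (lawL_box_killSE_sign hW (by omega) hS hN (Or.inl hE)).ne'
  · refine ⟨π / 3, pi_div_three_mem_Icc_walls, ?_⟩
    have e : killNE ((h.1 + 1, h.2) : Face) = ((h.1 + 2, h.2 + 2) : Face) :=
      Prod.ext (by simp only [killNE]; ring) (by simp only [killNE])
    rw [← e]
    exact ne_zero_of_im_ne_zeroW (lawL_box_killNE_sign hW (by omega) hS hN (Or.inl hE)).ne

/-- ★★★★★ **LAW L, EAST WALL: the three middle cells RESTORE the vertex relation somewhere on the range** — identically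
for the root plaquette's eastern neighbour `(h.1 + 2, h.2)`, at the dual angle `2π/3` for the south-eastern pocket
`(h.1 + 2, h.2 − 1)`, at the honeycomb angle `π/3` for the north-eastern pocket `(h.1 + 2, h.2 + 1)`.
[cite: GlazmanManolescu2019, Lemma 2.1 (statement, "in the form given in [Gl]"), §1 (remark after eq. (1)), §2.1]
[cite: Glazman2015WeightedSAW, Lemma 3.1 (proof, pp. 6–7)] -/
theorem lawL_eastWall_middle_exists_eq_zero (hW : 1 ≤ h.1) (hE : h.1 + 3 = m) (hS : 0 ≤ h.2) (hN : h.2 + 1 ≤ n)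
    {y : ℤ} (hy : h.2 - 1 ≤ y ∧ y ≤ h.2 + 1) :
    ∃ θ ∈ Set.Icc (π / 3) (2 * π / 3), vertexFunctional (printedWeights θ) tFiveEighths (ybCoeff θ)
      (boxMinus m n [h, (h.1 + 2, y)]) (Face.side (h.1 + 1, h.2) .W) (farW (h.1 + 1, h.2)) = 0 := by
  obtain ⟨hy1, hy2⟩ := hy
  have hcases : y = h.2 - 1 ∨ y = h.2 ∨ y = h.2 + 1 := by omega
  rcases hcases with rfl | rfl | rfl
  · exact ⟨2 * π / 3, two_pi_div_three_mem_Icc_walls,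
      lawL_box_eastWallPocketSE_vertexFunctional_two_pi_div_three_eq_zero hW hE hS hN⟩
  · exact ⟨π / 3, pi_div_three_mem_Icc_walls,
      lawL_box_eastWallRootE_vertexFunctional_eq_zero hW hE hS hN pi_div_three_mem_Icc_walls⟩
  · exact ⟨π / 3, pi_div_three_mem_Icc_walls,
      lawL_box_eastWallPocketNE_vertexFunctional_pi_div_three_eq_zero hW hE hS hN⟩

end Walls

end Literature.Barriers.CriticalPhenomena.PlaquetteWalk
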